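import Literature.NumberTheory.Automorphic.HilbertRepCompactFiniteType
import Literature.NumberTheory.Automorphic.HilbertRepDiscretePart
import Literature.NumberTheory.Automorphic.HilbertRepFiniteTypeIdempotent
import Literature.RepresentationTheory.CompactGroups.PeterWeylSeparation
import HarnessLib

/-!
# Peter–Weyl for every compact Hausdorff group: `G`-finite functions separate points, `G`-finite vectors are dense

Topic `NumberTheory/Automorphic`; namespace `Literature.NumberTheory.Automorphic` (continues
`CompactGroupKFiniteVectors` / `HilbertRepCompactFiniteType`).  Theorems and two auxiliary definitions
(`repCoeff`, `repCoeffₗ`: complex coefficient functions of a matrix representation); no named fact, no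
instance on a tree carrier, no `sorry`.

T. Bröcker, T. tom Dieck, *Representations of Compact Lie Groups* (GTM 98, 1985), III Theorem (3.1)
(Peter–Weyl: the representative functions are dense in `C⁰(G, ℂ)` and `L²(G)`), III (4.3), and III Theorem
(5.7): *"Let `G` be a compact Lie group and `V` a `G`-module" (a locally convex complete `G`-space) "… the
`G`-finite vectors" (those whose orbit spans a finite-dimensional subspace) "form a dense subspace of `V`."*
The tree's `CompactGroupKFiniteVectors` proves the engine of (5.6)–(5.7) — every `v ≠ 0` of a strongly
continuous Hilbert representation has a non-zero `G`-finite smear `π(ψ) v`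
(`exists_isTranslationFinite_smear_ne_zero`) — UNDER THE HYPOTHESIS
`hsep : (translationFiniteSubalgebra G).SeparatesPoints`, discharged there for compact MATRIX groups
(`separatesPoints_translationFiniteSubalgebra`) and in `HilbertRepCompactFiniteType` for PROFINITE groups.
Here the hypothesis is discharged for EVERY compact Hausdorff group, from the Peter–Weyl point-separation
theorem PROVED in the tree (`PeterWeyl.exists_unitary_rep_apply_ne_one`,
`RepresentationTheory/CompactGroups/PeterWeylSeparation.lean`: for `g ≠ 1` a continuous unitary matrix
representation `σ` with `σ g ≠ 1`), and (5.7) is proved in full for unitary Hilbert representations: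

* `isTranslationFinite_repCoeff` — the matrix coefficients `x ↦ ℓ(σ x)` (`ℓ` a linear functional on `M_n(ℂ)`)
  of a continuous matrix representation are `G`-finite (III (1.5));
* `separatesPoints_translationFiniteSubalgebra_of_compactSpace` — **the `G`-finite continuous functions
  separate the points of every compact Hausdorff group**;
* `translationFiniteSubalgebra_topologicalClosure_eq_top` / `dense_translationFiniteSubalgebra` — **the
  Peter–Weyl theorem III (3.1), `C⁰(G, ℂ)` part**, unconditional (complex Stone–Weierstrass);
* `exists_isTranslationFinite_smear_ne_zero_of_t2Space` / `exists_finiteDimensional_invariant_of_t2Space` —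
  the hypothesis-free forms of `exists_isTranslationFinite_smear_ne_zero` (III (5.6)) and of
  `exists_finiteDimensional_invariant_of_compactSpace` (every non-zero closed invariant subspace of a
  strongly continuous Hilbert representation of a compact Hausdorff group contains a non-zero
  finite-dimensional invariant subspace);
* `orthogonal_span_finiteVectors_eq_bot` / `topologicalClosure_span_finiteVectors_eq_top` /
  `dense_span_finiteVectors` — **III Theorem (5.7) for unitary Hilbert representations of a compact
  Hausdorff group**: the `G`-finite vectors `{v | dim span(G·v) < ∞}` (`ContRepresentation.orbitSpan` of
  `UnitaryIsotypicProjection`) span a DENSE subspace; a vector orthogonal to all `G`-finite vectors is `0`;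
* `finiteDimensional_of_isTopIrreducible` / `finiteDimensional_of_isTopIrreducible_toContRep` — **III Cor. (5.8) /
  Deitmar–Echterhoff Thm. 7.2.3 (a)**: a topologically irreducible strongly continuous Hilbert representation of a
  compact Hausdorff group (or such a closed subrepresentation) is finite-dimensional;
* `isDiscretelyDecomposable_of_compactSpace` / `discretePart_eq_top_of_compactSpace` /
  `mem_discretePart_of_compactSpace` — **III Thm. (5.10) (iii)–(iv) / Deitmar–Echterhoff Thm. 7.2.3 (b)** in the
  tree's vocabulary (`HilbertRepSpectrum`: `discretePart`, `IsDiscretelyDecomposable`): every UNITARY strongly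
  continuous Hilbert representation of a compact Hausdorff group is the closed span of its (finite-dimensional)
  irreducible closed subrepresentations — with no compact-operator hypothesis (contrast
  `IntegratedOperatorDiscreteness`, which needs `π(f)` compact).

The real-valued / two-sided form for `RepresentationTheory/CompactGroups/TranslationFinite` (`translationFinite G`
separates points and is dense in `C(G, ℝ)` and `Lᵖ`) is the companion `CompactGroups/PeterWeylDensity`.

## References
* T. Bröcker, T. tom Dieck, *Representations of Compact Lie Groups*, GTM 98 (1985), III (1.5), Thm. (3.1) (PDF p. 129),
  (4.3), (5.5)–(5.8), Thm. (5.10) (PDF pp. 134–135) [BrockerTomDieck1985].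
* A. Deitmar, S. Echterhoff, *Principles of Harmonic Analysis*, 2nd ed. (2014), Thm. 7.2.3 (PDF p. 194)
  [DeitmarEchterhoff2014].
* G. B. Folland, *A Course in Abstract Harmonic Analysis* (1995), Thm. 5.11–5.12 [Folland1995].

## Provenance
Lane `lit-hodgefound` (HOME `run/shared/lean/pub/lit-hodgefound/`), prover seat `lit-hodgefound-p05` generation 6
(Layer 0 beneath the `K`-type / `K`-finite-vector statements of the unitary-group and theta-correspondence layer).
-/

noncomputable section

open MeasureTheory ContinuousMap
open scoped InnerProductSpace
open Literature.RepresentationTheory.CompactGroups (PeterWeyl.exists_unitary_rep_apply_ne_one)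

namespace Literature.NumberTheory.Automorphic

/-! ### Complex matrix coefficients are `G`-finite -/

section Coefficients

variable {G : Type*} [TopologicalSpace G] [Group G]
variable {n : Type*} [Fintype n] [DecidableEq n] (σ : G →* Matrix n n ℂ) (hσ : Continuous σ)

/-- The **complex coefficient function** `x ↦ ℓ(σ x)` of a continuous matrix representation
`σ : G →* M_n(ℂ)` against a linear functional `ℓ` on `M_n(ℂ)` (`ℓ = (·)ᵢⱼ`: the matrix coefficient `rᵢⱼ`;
Bröcker–tom Dieck III (1.5)). [cite: BrockerTomDieck1985, III (1.5)] -/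
def repCoeff (ℓ : Matrix n n ℂ →ₗ[ℂ] ℂ) : C(G, ℂ) :=
  ⟨fun x => ℓ (σ x), ℓ.continuous_of_finiteDimensional.comp hσ⟩

/-- Unfolding `repCoeff`. [cite: BrockerTomDieck1985, III (1.5)] -/
@[simp] theorem repCoeff_apply (ℓ : Matrix n n ℂ →ₗ[ℂ] ℂ) (x : G) : repCoeff σ hσ ℓ x = ℓ (σ x) := rfl

/-- `ℓ ↦ repCoeff σ ℓ`, linear in the functional. [cite: BrockerTomDieck1985, III (1.5)] -/
def repCoeffₗ : (Matrix n n ℂ →ₗ[ℂ] ℂ) →ₗ[ℂ] C(G, ℂ) where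
  toFun := repCoeff σ hσ
  map_add' _ _ := by ext; simp
  map_smul' _ _ := by ext; simp

/-- Unfolding `repCoeffₗ`. [cite: BrockerTomDieck1985, III (1.5)] -/
@[simp] theorem repCoeffₗ_apply (ℓ : Matrix n n ℂ →ₗ[ℂ] ℂ) : repCoeffₗ σ hσ ℓ = repCoeff σ hσ ℓ := rfl

/-- The coefficient functions of `σ` form a finite-dimensional space (an image of the dual of `M_n(ℂ)`).
[cite: BrockerTomDieck1985, III (1.5)] -/
instance finiteDimensional_range_repCoeffₗ : FiniteDimensional ℂ (LinearMap.range (repCoeffₗ σ hσ)) :=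
  LinearMap.finiteDimensional_range _

variable [IsTopologicalGroup G]

/-- **Left translates of coefficient functions are coefficient functions**:
`(λ(g) (x ↦ ℓ(σ x)))(x) = ℓ(σ g⁻¹ · σ x)`. [cite: BrockerTomDieck1985, III (1.5)] -/
theorem leftTranslate_repCoeff (g : G) (ℓ : Matrix n n ℂ →ₗ[ℂ] ℂ) :
    leftTranslate g (repCoeff σ hσ ℓ) = repCoeff σ hσ (ℓ ∘ₗ LinearMap.mulLeft ℂ (σ g⁻¹)) := by
  ext x
  simp [map_mul]

/-- **Matrix coefficients of a continuous finite-dimensional representation are `G`-finite** (their left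
translates stay in the finite-dimensional space of coefficient functions of `σ`; Bröcker–tom Dieck III (1.5)
and the lines after it). [cite: BrockerTomDieck1985, III (1.5)] -/
theorem isTranslationFinite_repCoeff (ℓ : Matrix n n ℂ →ₗ[ℂ] ℂ) : IsTranslationFinite (repCoeff σ hσ ℓ) :=
  ⟨LinearMap.range (repCoeffₗ σ hσ), inferInstance, fun g =>
    ⟨ℓ ∘ₗ LinearMap.mulLeft ℂ (σ g⁻¹), by rw [repCoeffₗ_apply, leftTranslate_repCoeff]⟩⟩

/-- Coefficient functions lie in the star subalgebra `translationFiniteSubalgebra G`.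
[cite: BrockerTomDieck1985, III (1.5)] -/
theorem repCoeff_mem_translationFiniteSubalgebra (ℓ : Matrix n n ℂ →ₗ[ℂ] ℂ) :
    repCoeff σ hσ ℓ ∈ translationFiniteSubalgebra G :=
  isTranslationFinite_repCoeff σ hσ ℓ

end Coefficients

/-! ### Separation of points and density in `C(G, ℂ)` -/

section Separation

variable {G : Type*} [TopologicalSpace G] [Group G] [IsTopologicalGroup G] [CompactSpace G] [T2Space G]

/-- **The `G`-finite continuous functions separate the points of every compact Hausdorff group**
(Bröcker–tom Dieck III (3.1) with (4.3); Folland Thm. 5.11): for `x ≠ y` the tree's Peter–Weyl separation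
theorem gives a continuous unitary matrix representation `σ` with `σ (x y⁻¹) ≠ 1`, so `σ x ≠ σ y`, some linear
functional `ℓ` on `M_n(ℂ)` has `ℓ(σ x) ≠ ℓ(σ y)`, and `repCoeff σ ℓ` is `G`-finite.  This discharges the
hypothesis `hsep` of `exists_isTranslationFinite_smear_ne_zero` / `exists_finiteDimensional_invariant_of_compactSpace`
for all compact Hausdorff groups. [cite: BrockerTomDieck1985, III Thm (3.1)] -/
theorem separatesPoints_translationFiniteSubalgebra_of_compactSpace (G : Type*) [TopologicalSpace G] [Group G]
    [IsTopologicalGroup G] [CompactSpace G] [T2Space G] :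
    (translationFiniteSubalgebra G).SeparatesPoints := by
  intro x y hxy
  have hg : x * y⁻¹ ≠ 1 := fun h => hxy (mul_inv_eq_one.mp h)
  obtain ⟨k, σ, hσc, -, hσ1⟩ := PeterWeyl.exists_unitary_rep_apply_ne_one (G := G) hg
  have hne : σ x - σ y ≠ 0 := by
    intro h
    apply hσ1
    rw [sub_eq_zero] at h
    rw [map_mul, h, ← map_mul, mul_inv_cancel, map_one]
  obtain ⟨ℓ, hℓ⟩ := not_forall.mp (mt (Module.forall_dual_apply_eq_zero_iff ℂ _).mp hne)
  refine ⟨repCoeff σ hσc ℓ, ⟨repCoeff σ hσc ℓ, repCoeff_mem_translationFiniteSubalgebra σ hσc ℓ, rfl⟩, ?_⟩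
  intro h
  apply hℓ
  have h' : ℓ (σ x) = ℓ (σ y) := h
  rw [map_sub, h', sub_self]

/-- **The Peter–Weyl theorem, `C⁰(G, ℂ)` part, for every compact Hausdorff group**: the star subalgebra of
`G`-finite continuous functions is dense in `C(G, ℂ)` — its uniform closure is everything (complex
Stone–Weierstrass, Mathlib `ContinuousMap.starSubalgebra_topologicalClosure_eq_top_of_separatesPoints`).
[cite: BrockerTomDieck1985, III Thm (3.1)] -/
theorem translationFiniteSubalgebra_topologicalClosure_eq_top :
    (translationFiniteSubalgebra G).topologicalClosure = ⊤ :=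
  ContinuousMap.starSubalgebra_topologicalClosure_eq_top_of_separatesPoints _
    (separatesPoints_translationFiniteSubalgebra_of_compactSpace G)

/-- **The Peter–Weyl theorem, `Dense` form**: `G`-finite continuous functions are dense in `C(G, ℂ)`.
[cite: BrockerTomDieck1985, III Thm (3.1)] -/
theorem dense_translationFiniteSubalgebra :
    Dense ((translationFiniteSubalgebra G : StarSubalgebra ℂ C(G, ℂ)) : Set C(G, ℂ)) := by
  rw [dense_iff_closure_eq, ← StarSubalgebra.topologicalClosure_coe,
    translationFiniteSubalgebra_topologicalClosure_eq_top]
  rfl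

end Separation

/-! ### Non-zero `G`-finite vectors and finite-dimensional invariant subspaces, hypothesis-free -/

section Smear

variable {G : Type*} [TopologicalSpace G] [Group G] [IsTopologicalGroup G] [MeasurableSpace G] [BorelSpace G]
  [CompactSpace G] [T2Space G]
  {H : Type*} [NormedAddCommGroup H] [InnerProductSpace ℂ H] [CompleteSpace H]

/-- **Every non-zero vector of a strongly continuous Hilbert representation of a compact Hausdorff group has a
non-zero `G`-finite smear** `π(ψ) v`, `ψ` `G`-finite, whose orbit spans a finite-dimensional subspace
(Bröcker–tom Dieck III (5.6); `exists_isTranslationFinite_smear_ne_zero` with its separation hypothesis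
discharged by `separatesPoints_translationFiniteSubalgebra_of_compactSpace`). [cite: BrockerTomDieck1985, III (5.6)–(5.7)] -/
theorem exists_isTranslationFinite_smear_ne_zero_of_t2Space {π : ContRepresentation ℂ G H} {μ : Measure G}
    [IsFiniteMeasureOnCompacts μ] [μ.IsOpenPosMeasure] [μ.IsMulLeftInvariant] (hπ : π.IsStronglyContinuous)
    {v : H} (hv : v ≠ 0) :
    ∃ ψ : C(G, ℂ), IsTranslationFinite ψ ∧ smear π μ ψ v ≠ 0 ∧
      FiniteDimensional ℂ (Submodule.span ℂ (Set.range fun g : G => π g (smear π μ ψ v))) :=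
  exists_isTranslationFinite_smear_ne_zero hπ (separatesPoints_translationFiniteSubalgebra_of_compactSpace G) hv

/-- **Every non-zero closed invariant subspace of a strongly continuous Hilbert representation of a compact
Hausdorff group contains a non-zero finite-dimensional invariant subspace** (Bröcker–tom Dieck III
(5.6)–(5.7); `exists_finiteDimensional_invariant_of_compactSpace` with `hsep` discharged).
[cite: BrockerTomDieck1985, III (5.6)–(5.7)] -/
theorem exists_finiteDimensional_invariant_of_t2Space (π : ContRepresentation ℂ G H)
    (hπ : π.IsStronglyContinuous) (μ : Measure G) [IsFiniteMeasureOnCompacts μ] [μ.IsOpenPosMeasure]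
    [μ.IsMulLeftInvariant] (S : Submodule ℂ H) (hS : IsClosed (S : Set H))
    (hinv : ∀ (g : G), ∀ w ∈ S, π g w ∈ S) (hS0 : S ≠ ⊥) :
    ∃ V : Submodule ℂ H, FiniteDimensional ℂ V ∧ V ≤ S ∧ V ≠ ⊥ ∧ ∀ (g : G), ∀ v ∈ V, π g v ∈ V :=
  exists_finiteDimensional_invariant_of_compactSpace π hπ μ
    (separatesPoints_translationFiniteSubalgebra_of_compactSpace G) S hS hinv hS0

end Smear

/-! ### Bröcker–tom Dieck III (5.7): the `G`-finite vectors are dense -/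

section Density

variable {G : Type*} [TopologicalSpace G] [Group G] [IsTopologicalGroup G] [CompactSpace G] [T2Space G]
  {H : Type*} [NormedAddCommGroup H] [InnerProductSpace ℂ H] [CompleteSpace H]
  {π : ContRepresentation ℂ G H}

omit [TopologicalSpace G] [IsTopologicalGroup G] [CompactSpace G] [T2Space G] [CompleteSpace H] in
/-- Translates of `G`-finite vectors are `G`-finite (the orbit of `π g v` lies in the orbit span of `v`).
[cite: BrockerTomDieck1985, III (5.7)] -/
theorem finiteDimensional_orbitSpan_apply {v : H} (hv : FiniteDimensional ℂ (π.orbitSpan v)) (g : G) :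
    FiniteDimensional ℂ (π.orbitSpan (π g v)) :=
  Submodule.finiteDimensional_of_le
    (π.orbitSpan_le (fun k _ hw => π.apply_mem_orbitSpan_of_mem k hw) (π.apply_mem_orbitSpan g v))

omit [TopologicalSpace G] [IsTopologicalGroup G] [CompactSpace G] [T2Space G] [CompleteSpace H] in
/-- The span of the `G`-finite vectors is invariant. [cite: BrockerTomDieck1985, III (5.7)] -/
theorem apply_mem_span_finiteVectors (g : G) {v : H}
    (hv : v ∈ Submodule.span ℂ {v : H | FiniteDimensional ℂ (π.orbitSpan v)}) :
    π g v ∈ Submodule.span ℂ {v : H | FiniteDimensional ℂ (π.orbitSpan v)} := by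
  induction hv using Submodule.span_induction with
  | mem x hx => exact Submodule.subset_span (finiteDimensional_orbitSpan_apply hx g)
  | zero => rw [map_zero]; exact Submodule.zero_mem _
  | add x y _ _ hx hy => rw [map_add]; exact Submodule.add_mem _ hx hy
  | smul c x _ hx => rw [map_smul]; exact Submodule.smul_mem _ c hx

/-- **A vector orthogonal to every `G`-finite vector is zero** (Bröcker–tom Dieck III Thm. (5.7) for a
unitary, strongly continuous Hilbert representation `π` of a compact Hausdorff group): the orthogonal
complement `T` of the span of the `G`-finite vectors is closed and — `π` being unitary — invariant, so a
non-zero `v ∈ T` would have a non-zero `G`-finite smear `π(ψ) v ∈ T` (smears by Haar measure stay in closed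
invariant subspaces), which is also a `G`-finite vector: `π(ψ) v ∈ T ∩ T^⊥ = 0`, contradiction.
[cite: BrockerTomDieck1985, III Thm (5.7)] -/
theorem orthogonal_span_finiteVectors_eq_bot (hπ : π.IsStronglyContinuous) (hu : π.IsUnitary) :
    (Submodule.span ℂ {v : H | FiniteDimensional ℂ (π.orbitSpan v)})ᗮ = ⊥ := by
  letI : MeasurableSpace G := borel G
  haveI : BorelSpace G := ⟨rfl⟩
  set S : Submodule ℂ H := Submodule.span ℂ {v : H | FiniteDimensional ℂ (π.orbitSpan v)} with hS
  have hSinv : ∀ g, ∀ v ∈ S, π g v ∈ S := fun g v hv => apply_mem_span_finiteVectors g hv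
  have hTinv : ∀ g, ∀ w ∈ Sᗮ, π g w ∈ Sᗮ := fun g w hw => hu.apply_mem_orthogonal hSinv g hw
  rw [Submodule.eq_bot_iff]
  intro v hv
  by_contra hv0
  obtain ⟨ψ, -, hne, hfd⟩ :=
    exists_isTranslationFinite_smear_ne_zero_of_t2Space (π := π) (μ := Measure.haar) hπ hv0
  have hwT : smear π Measure.haar ψ v ∈ Sᗮ :=
    smear_mem_of_isClosed hπ (Submodule.isClosed_orthogonal S) hTinv ψ hv
  have hwS : smear π Measure.haar ψ v ∈ S :=
    Submodule.subset_span (show FiniteDimensional ℂ (π.orbitSpan (smear π Measure.haar ψ v)) from hfd)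
  have hw : smear π Measure.haar ψ v ∈ S ⊓ Sᗮ := ⟨hwS, hwT⟩
  rw [Submodule.inf_orthogonal_eq_bot, Submodule.mem_bot] at hw
  exact hne hw

/-- **Bröcker–tom Dieck III Thm. (5.7): the `G`-finite vectors of a unitary strongly continuous Hilbert
representation of a compact Hausdorff group span a dense subspace** — the closure of their span is
everything. [cite: BrockerTomDieck1985, III Thm (5.7)] -/
theorem topologicalClosure_span_finiteVectors_eq_top (hπ : π.IsStronglyContinuous) (hu : π.IsUnitary) :
    (Submodule.span ℂ {v : H | FiniteDimensional ℂ (π.orbitSpan v)}).topologicalClosure = ⊤ := by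
  rw [Submodule.topologicalClosure_eq_top_iff]
  exact orthogonal_span_finiteVectors_eq_bot hπ hu

/-- **Bröcker–tom Dieck III Thm. (5.7), `Dense` form**: finite sums of `G`-finite vectors are dense.
[cite: BrockerTomDieck1985, III Thm (5.7)] -/
theorem dense_span_finiteVectors (hπ : π.IsStronglyContinuous) (hu : π.IsUnitary) :
    Dense (Submodule.span ℂ {v : H | FiniteDimensional ℂ (π.orbitSpan v)} : Set H) := by
  rw [dense_iff_closure_eq, ← Submodule.topologicalClosure_coe,
    topologicalClosure_span_finiteVectors_eq_top hπ hu]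
  rfl

/-- **(5.7), test form**: a vector whose inner products with all `G`-finite vectors vanish is `0`.
[cite: BrockerTomDieck1985, III Thm (5.7)] -/
theorem eq_zero_of_forall_inner_finiteVector_eq_zero (hπ : π.IsStronglyContinuous) (hu : π.IsUnitary)
    {w : H} (h : ∀ v : H, FiniteDimensional ℂ (π.orbitSpan v) → ⟪v, w⟫_ℂ = 0) : w = 0 := by
  have hw : w ∈ (Submodule.span ℂ {v : H | FiniteDimensional ℂ (π.orbitSpan v)})ᗮ := by
    rw [Submodule.mem_orthogonal']
    intro u hu'
    rw [inner_eq_zero_symm]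
    induction hu' using Submodule.span_induction with
    | mem x hx => exact h x hx
    | zero => exact inner_zero_left _
    | add x y _ _ hx hy => rw [inner_add_left, hx, hy, add_zero]
    | smul c x _ hx => rw [inner_smul_left, hx, mul_zero]
  rw [orthogonal_span_finiteVectors_eq_bot hπ hu, Submodule.mem_bot] at hw
  exact hw

end Density

/-! ### Irreducible representations are finite-dimensional; unitary representations are discretely decomposable -/

section Discrete

variable {G : Type*} [TopologicalSpace G] [Group G] [IsTopologicalGroup G] [CompactSpace G] [T2Space G]
  {H : Type*} [NormedAddCommGroup H] [InnerProductSpace ℂ H] [CompleteSpace H]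
  {π : ContRepresentation ℂ G H}

omit [TopologicalSpace G] [IsTopologicalGroup G] [CompactSpace G] [T2Space G] [CompleteSpace H] in
/-- **A minimal non-zero finite-dimensional invariant subspace is a topologically irreducible closed
subrepresentation** (it is closed, being finite-dimensional, and its closed invariant subspaces are invariant
subspaces). [cite: BrockerTomDieck1985, III (5.8)] -/
theorem isTopIrreducible_ofSubmodule_of_minimal {W : Submodule ℂ H} [FiniteDimensional ℂ W] (hW0 : W ≠ ⊥)
    (hWinv : ∀ g : G, ∀ v ∈ W, π g v ∈ W)
    (hmin : ∀ W' : Submodule ℂ H, W' ≤ W → (∀ g : G, ∀ v ∈ W', π g v ∈ W') → W' = ⊥ ∨ W' = W) :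
    (ContRepresentation.ClosedSubrep.ofSubmodule W W.closed_of_finiteDimensional hWinv).toContRep.IsTopIrreducible := by
  rw [ContRepresentation.ClosedSubrep.isTopIrreducible_toContRep_iff]
  refine ⟨fun h => hW0 ?_, fun W' hW' => ?_⟩
  · have h' := congrArg (fun Z : ContRepresentation.ClosedSubrep π => Z.toSubmodule) h
    rwa [ContRepresentation.ClosedSubrep.toSubmodule_ofSubmodule,
      ContRepresentation.ClosedSubrep.toSubmodule_bot] at h'
  · have hle : W'.toSubmodule ≤ W := ContRepresentation.ClosedSubrep.toSubmodule_le_iff.mpr hW'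
    rcases hmin W'.toSubmodule hle (fun g v hv => W'.apply_mem g hv) with h | h
    · left
      ext v
      rw [ContRepresentation.ClosedSubrep.mem_bot, ← ContRepresentation.ClosedSubrep.mem_toSubmodule, h,
        Submodule.mem_bot]
    · right
      ext v
      rw [← ContRepresentation.ClosedSubrep.mem_toSubmodule, h,
        ContRepresentation.ClosedSubrep.mem_ofSubmodule]

omit [IsTopologicalGroup G] [CompactSpace G] [T2Space G] [CompleteSpace H] in
/-- The representation on a closed subrepresentation of a strongly continuous representation is strongly
continuous. [cite: BrockerTomDieck1985, III (5.8)] -/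
theorem isStronglyContinuous_toContRep_of_isStronglyContinuous (hπ : π.IsStronglyContinuous)
    (W : ContRepresentation.ClosedSubrep π) : W.toContRep.IsStronglyContinuous := fun v =>
  Continuous.subtype_mk (hπ (v : H)) _

/-- **An irreducible strongly continuous Hilbert representation of a compact Hausdorff group is
finite-dimensional** (Bröcker–tom Dieck III Cor. (5.8); Deitmar–Echterhoff Thm. 7.2.3 (a)): it contains a
non-zero finite-dimensional invariant subspace (`exists_finiteDimensional_invariant_of_t2Space`), which is closed,
hence everything. [cite: BrockerTomDieck1985, III (5.8)] [cite: DeitmarEchterhoff2014, Thm 7.2.3] -/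
theorem finiteDimensional_of_isTopIrreducible (hπ : π.IsStronglyContinuous) (hirr : π.IsTopIrreducible) :
    FiniteDimensional ℂ H := by
  letI : MeasurableSpace G := borel G
  haveI : BorelSpace G := ⟨rfl⟩
  obtain ⟨hnt, hall⟩ := (ContRepresentation.isTopIrreducible_iff π).mp hirr
  have htop : (⊤ : Submodule ℂ H) ≠ ⊥ := bot_ne_top.symm
  obtain ⟨V, hVfd, -, hV0, hVinv⟩ := exists_finiteDimensional_invariant_of_t2Space π hπ Measure.haar ⊤
    (by rw [Submodule.top_coe]; exact isClosed_univ) (fun _ _ _ => Submodule.mem_top) htop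
  haveI := hVfd
  rcases hall (ContRepresentation.ClosedSubrep.ofSubmodule V V.closed_of_finiteDimensional hVinv) with h | h
  · have h' := congrArg (fun Z : ContRepresentation.ClosedSubrep π => Z.toSubmodule) h
    rw [ContRepresentation.ClosedSubrep.toSubmodule_ofSubmodule,
      ContRepresentation.ClosedSubrep.toSubmodule_bot] at h'
    exact absurd h' hV0
  · have h' := congrArg (fun Z : ContRepresentation.ClosedSubrep π => Z.toSubmodule) h
    rw [ContRepresentation.ClosedSubrep.toSubmodule_ofSubmodule,
      ContRepresentation.ClosedSubrep.toSubmodule_top] at h'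
    haveI : FiniteDimensional ℂ (⊤ : Submodule ℂ H) := h' ▸ hVfd
    exact LinearEquiv.finiteDimensional (Submodule.topEquiv : (⊤ : Submodule ℂ H) ≃ₗ[ℂ] H)

/-- **Irreducible closed subrepresentations of a strongly continuous Hilbert representation of a compact
Hausdorff group are finite-dimensional** (Deitmar–Echterhoff Thm. 7.2.3 (a)).
[cite: DeitmarEchterhoff2014, Thm 7.2.3] [cite: BrockerTomDieck1985, III (5.8)] -/
theorem finiteDimensional_of_isTopIrreducible_toContRep (hπ : π.IsStronglyContinuous)
    {W : ContRepresentation.ClosedSubrep π} (hW : W.toContRep.IsTopIrreducible) :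
    FiniteDimensional ℂ W.toSubmodule :=
  finiteDimensional_of_isTopIrreducible (isStronglyContinuous_toContRep_of_isStronglyContinuous hπ W) hW

/-- **Every unitary strongly continuous Hilbert representation of a compact Hausdorff group is discretely
decomposable** — the closed span of its (finite-dimensional) topologically irreducible closed subrepresentations
is the whole space (Bröcker–tom Dieck III Thm. (5.10) (iii)–(iv): `H` is the Hilbert sum of the isotypic parts
`H_χ`, each the closure of its irreducible subspaces; Deitmar–Echterhoff Thm. 7.2.3 (b): every unitary
representation of a compact group is an orthogonal sum of irreducibles).  Proof: the orthogonal complement `D` of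
the discrete part is a closed invariant subspace; were it non-zero it would contain a non-zero finite-dimensional
invariant subspace (`exists_finiteDimensional_invariant_of_t2Space`), hence a minimal one, which is an irreducible
closed subrepresentation inside `D` — impossible (`ClosedSubrep.not_isTopIrreducible_of_le_orthogonal_discretePart`).
[cite: BrockerTomDieck1985, III Thm (5.10)] [cite: DeitmarEchterhoff2014, Thm 7.2.3] -/
theorem isDiscretelyDecomposable_of_compactSpace (hπ : π.IsStronglyContinuous) (hu : π.IsUnitary) :
    π.IsDiscretelyDecomposable := by
  letI : MeasurableSpace G := borel G
  haveI : BorelSpace G := ⟨rfl⟩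
  rw [ContRepresentation.isDiscretelyDecomposable_iff_orthogonal_discretePart_eq_bot hu]
  by_contra hne
  set D : ContRepresentation.ClosedSubrep π := π.discretePart.orthogonal hu with hD
  have hD0 : D.toSubmodule ≠ ⊥ := fun h => hne (by
    ext v
    rw [ContRepresentation.ClosedSubrep.mem_bot, ← ContRepresentation.ClosedSubrep.mem_toSubmodule, h,
      Submodule.mem_bot])
  obtain ⟨V, hVfd, hVle, hV0, hVinv⟩ := exists_finiteDimensional_invariant_of_t2Space π hπ Measure.haar
    D.toSubmodule D.isClosed' (fun g w hw => D.apply_mem g hw) hD0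
  haveI := hVfd
  -- a minimal non-zero invariant subspace of `V` (least dimension; `HilbertRepFiniteTypeIdempotent`)
  obtain ⟨W, hWV, hW0, hWinv', hmin'⟩ :=
    ContRepresentation.exists_minimal_invariant_of_finiteDimensional (Set.range fun g : G => (π g : H →L[ℂ] H))
      V hV0 (by rintro _ ⟨g, rfl⟩ v hv; exact hVinv g v hv)
  have hWinv : ∀ g : G, ∀ v ∈ W, π g v ∈ W := fun g v hv => hWinv' _ ⟨g, rfl⟩ v hv
  have hmin : ∀ W' : Submodule ℂ H, W' ≤ W → (∀ g : G, ∀ v ∈ W', π g v ∈ W') → W' = ⊥ ∨ W' = W :=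
    fun W' hW' hinv => hmin' W' hW' (by rintro _ ⟨g, rfl⟩ v hv; exact hinv g v hv)
  haveI : FiniteDimensional ℂ W := Submodule.finiteDimensional_of_le hWV
  have hirr := isTopIrreducible_ofSubmodule_of_minimal hW0 hWinv hmin
  have hle : ContRepresentation.ClosedSubrep.ofSubmodule W W.closed_of_finiteDimensional hWinv ≤ D :=
    ContRepresentation.ClosedSubrep.toSubmodule_le_iff.mp (hWV.trans hVle)
  exact ContRepresentation.ClosedSubrep.not_isTopIrreducible_of_le_orthogonal_discretePart hu hle hirr

/-- Equivalently: the discrete part of a unitary strongly continuous Hilbert representation of a compact Hausdorff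
group is everything. [cite: BrockerTomDieck1985, III Thm (5.10)] -/
theorem discretePart_eq_top_of_compactSpace (hπ : π.IsStronglyContinuous) (hu : π.IsUnitary) :
    π.discretePart = ⊤ :=
  isDiscretelyDecomposable_of_compactSpace hπ hu

/-- … so every vector lies in the closed span of the irreducible (finite-dimensional) closed subrepresentations.
[cite: BrockerTomDieck1985, III Thm (5.10)] -/
theorem mem_discretePart_of_compactSpace (hπ : π.IsStronglyContinuous) (hu : π.IsUnitary) (v : H) :
    v ∈ π.discretePart := by
  rw [discretePart_eq_top_of_compactSpace hπ hu]
  exact ContRepresentation.ClosedSubrep.mem_top v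

end Discrete

end Literature.NumberTheory.Automorphic

end
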